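import Mathlib.NumberTheory.Padics.Hensel
import Literature.NumberTheory.QuadraticFields.Sqrt41
import Literature.NumberTheory.NumberFields.PadicEmbeddingValuation
import HarnessLib

/-!
# The real quadratic field `ℚ(√41)`, II: the places above `2`, `3`, `5` and the square theorem

Continuation of `Sqrt41.lean` (`K = ℚ(√41)` as `QuadraticAlgebra ℚ 41 0`, class number one,
totally positive units are squares), towards the complete `2`-descent of `E = 480a1` over `K`
(T. Dokchitser–V. Dokchitser, *A note on the Mordell–Weil rank modulo n*, J. Number Theory 131
(2011), proof of Thm. 2). The bad primes of `E` are `2, 3, 5`; in `K`, `2 = π₂ π₂'` and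
`5 = π₅ π₅'` split (`41 ≡ 1 mod 8`, `41 ≡ 1 mod 5`) and `3` is inert. Everything is PROVED:

* `sqrt41_two : ℤ₂`, `sqrt41_five : ℤ₅` — square roots of `41` (Hensel) with
  `√41 ≡ 13 (mod 64)` in `ℤ₂` and `√41 ≡ 21 (mod 25)` in `ℤ₅`; the embeddings
  `ι s : K →ₐ[ℚ] ℚ₂`, `κ s : K →ₐ[ℚ] ℚ₅` (`√41 ↦ s √41`, `s = ±1`);
* the primes: `(π₂) , (π₂')` above `2` (from part I), `(3)` (inert: `eq_span_three`),
  `(π₅), (π₅')` above `5` with `π₅ = 6 + √41`, `π₅' = √41 - 6`, and the dictionary with the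
  embeddings: `ord_(π₂) = v₂ ∘ ι 1`, `ord_(π₂') = v₂ ∘ ι (-1)`, `ord_(π₅) = v₅ ∘ κ (-1)`,
  `ord_(π₅') = v₅ ∘ κ 1` (`PadicEmbeddingValuation.lean`), `ord_(3) = v₃ ∘ N / 2`;
* **the square theorem in local terms** (`exists_sq_eq_of_local_data`): `z ∈ Kˣ` with even
  valuation at all primes not dividing `30`, even `2`-adic valuation under both `ι ±1`, `4 ∣ v₃(N z)`,
  even `5`-adic valuation under both `κ ±1`, and positive under both real embeddings, is a square.

## References

* T. Dokchitser, V. Dokchitser, *A note on the Mordell–Weil rank modulo n*, J. Number Theory 131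
  (2011) 1833–1839, proof of Thm. 2. [DokchitserDokchitser2011RankModN]
* J. Neukirch, *Algebraic Number Theory* (1999), Ch. II §8; D. A. Marcus, *Number Fields*,
  Ch. 3 (splitting of primes in quadratic fields). [folklore]
-/

noncomputable section

open scoped Classical

open Module NumberField QuadraticAlgebra IsDedekindDomain IsDedekindDomain.HeightOneSpectrum WithZero
open Literature.NumberTheory.NumberFields

namespace Literature.NumberTheory.QuadraticFields.Sqrt41

/-! ### Square roots of `41` in `ℤ₂` and `ℤ₅` -/

/-- The polynomial `X² - 41 ∈ ℤ[X]` and its values. [folklore] -/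
theorem aeval_sq_sub {R : Type*} [CommRing R] (x : R) :
    (Polynomial.X ^ 2 - 41 : Polynomial ℤ).aeval x = x ^ 2 - 41 := by
  simp [map_ofNat]

/-- The derivative `2X` of `X² - 41` and its values. [folklore] -/
theorem aeval_derivative_sq_sub {R : Type*} [CommRing R] (x : R) :
    (Polynomial.derivative (Polynomial.X ^ 2 - 41 : Polynomial ℤ)).aeval x = 2 * x := by
  simp [map_ofNat]

/-- `‖13‖ = 1` in `ℤ₂`. [folklore] -/
theorem norm_thirteen_two : ‖(13 : ℤ_[2])‖ = 1 := by
  rw [show (13 : ℤ_[2]) = ((13 : ℕ) : ℤ_[2]) by norm_num, PadicInt.norm_natCast_eq_one_iff]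
  decide

/-- `‖2‖ = 1/2` in `ℤ₂`. [folklore] -/
theorem norm_two_two : ‖(2 : ℤ_[2])‖ = 2⁻¹ := by
  have := @PadicInt.norm_p 2 _; simpa using this

/-- **`41` is a `2`-adic square**: there is `r ∈ ℤ₂` with `r² = 41` and `‖r - 13‖ < 1/2`
(Hensel at `a = 13`: `13² - 41 = 2⁷`, `‖2·13‖² = 1/4`). [folklore] -/
theorem exists_sqrt41_two : ∃ r : ℤ_[2], r ^ 2 = 41 ∧ ‖r - 13‖ < 1 / 2 := by
  have hder : ‖(Polynomial.derivative (Polynomial.X ^ 2 - 41 : Polynomial ℤ)).aeval (13 : ℤ_[2])‖ =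
      1 / 2 := by
    rw [aeval_derivative_sq_sub, norm_mul, norm_two_two, norm_thirteen_two]; norm_num
  have hF : ‖(Polynomial.X ^ 2 - 41 : Polynomial ℤ).aeval (13 : ℤ_[2])‖ <
      ‖(Polynomial.derivative (Polynomial.X ^ 2 - 41 : Polynomial ℤ)).aeval (13 : ℤ_[2])‖ ^ 2 := by
    rw [hder, aeval_sq_sub, show (13 : ℤ_[2]) ^ 2 - 41 = 2 ^ 7 by norm_num, norm_pow, norm_two_two]
    norm_num
  obtain ⟨r, hr, hdist, -, -⟩ := hensels_lemma hF
  refine ⟨r, ?_, ?_⟩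
  · rw [aeval_sq_sub] at hr
    linear_combination hr
  · rwa [hder] at hdist

/-- `√41 ∈ ℤ₂`, the root `≡ 1 (mod 4)` (in fact `≡ 13 (mod 64)`). [folklore] -/
def sqrt41Two : ℤ_[2] := Classical.choose exists_sqrt41_two

/-- `sqrt41Two² = 41`. [folklore] -/
theorem sqrt41Two_sq : sqrt41Two ^ 2 = 41 := (Classical.choose_spec exists_sqrt41_two).1

/-- `‖sqrt41Two - 13‖ < 1/2`. [folklore] -/
theorem norm_sqrt41Two_sub : ‖sqrt41Two - 13‖ < 1 / 2 := (Classical.choose_spec exists_sqrt41_two).2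

/-- `sqrt41Two ≡ 13 ≡ 1 (mod 4)`. [folklore] -/
theorem toZModPow_two_sqrt41Two : PadicInt.toZModPow 2 sqrt41Two = 13 := by
  have h : sqrt41Two - 13 ∈ Ideal.span {((2 : ℕ) : ℤ_[2]) ^ 2} := by
    rw [← PadicInt.norm_le_pow_iff_mem_span_pow]
    have h' : ‖sqrt41Two - 13‖ < ((2 : ℕ) : ℝ) ^ (-(1 : ℤ)) := by
      have := norm_sqrt41Two_sub; norm_num; linarith
    have h'' := (PadicInt.norm_lt_pow_iff_norm_le_pow_sub_one _ _).mp h'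
    have e : ((-1 : ℤ) - 1) = -((2 : ℕ) : ℤ) := by norm_num
    rwa [e] at h''
  rw [← PadicInt.ker_toZModPow, RingHom.mem_ker, map_sub] at h
  have h13 : PadicInt.toZModPow 2 (13 : ℤ_[2]) = 13 := by
    rw [show (13 : ℤ_[2]) = ((13 : ℕ) : ℤ_[2]) by norm_num, map_natCast]; rfl
  rw [h13] at h
  exact sub_eq_zero.mp h

set_option maxRecDepth 20000 in
/-- In `ℤ/128`: a square root of `41` which is `1 mod 4` is `13 mod 64`. [folklore] -/
theorem zmod128_sqrt41 : ∀ s : ZMod 128, s ^ 2 = 41 → s.val % 4 = 1 → s.val % 64 = 13 := by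
  decide

/-- Residues of `toZModPow`: the value modulo `p^m` is the value modulo `p^n` reduced. [folklore] -/
theorem val_toZModPow_mod {p : ℕ} [Fact p.Prime] (m n : ℕ) (h : m ≤ n) (x : ℤ_[p]) :
    (PadicInt.toZModPow n x).val % p ^ m = (PadicInt.toZModPow m x).val := by
  have := PadicInt.cast_toZModPow m n h x
  rw [ZMod.cast_eq_val] at this
  rw [← this, ZMod.val_natCast]

/-- **`√41 ≡ 13 (mod 64)` in `ℤ₂`.** [folklore] -/
theorem toZModPow_six_sqrt41Two : PadicInt.toZModPow 6 sqrt41Two = 13 := by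
  have hsq : (PadicInt.toZModPow 7 sqrt41Two) ^ 2 = 41 := by
    rw [← map_pow, sqrt41Two_sq, show (41 : ℤ_[2]) = ((41 : ℕ) : ℤ_[2]) by norm_num, map_natCast]; rfl
  have h4 : (PadicInt.toZModPow 7 sqrt41Two).val % 4 = 1 := by
    have := val_toZModPow_mod 2 7 (by norm_num) sqrt41Two
    rw [toZModPow_two_sqrt41Two] at this
    exact this.trans (by decide)
  have h64 := zmod128_sqrt41 _ hsq h4
  have h6 := val_toZModPow_mod 6 7 (by norm_num) sqrt41Two
  have h6' : (PadicInt.toZModPow 6 sqrt41Two).val = 13 := by rw [← h6]; exact h64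
  apply ZMod.val_injective
  rw [h6']
  decide

/-- `5` is prime (instance for `ℤ_[5]`). [folklore] -/
instance fact_prime_five' : Fact (Nat.Prime 5) := ⟨by norm_num⟩

/-- `‖2‖ = 1` and `‖40‖ = 1/5` in `ℤ₅`. [folklore] -/
theorem norm_two_five : ‖(2 : ℤ_[5])‖ = 1 ∧ ‖(40 : ℤ_[5])‖ = 5⁻¹ := by
  constructor
  · rw [show (2 : ℤ_[5]) = ((2 : ℕ) : ℤ_[5]) by norm_num, PadicInt.norm_natCast_eq_one_iff]; decide
  · rw [show (40 : ℤ_[5]) = (5 : ℤ_[5]) * 8 by norm_num, norm_mul]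
    have h5 : ‖(5 : ℤ_[5])‖ = 5⁻¹ := by have := @PadicInt.norm_p 5 _; simpa using this
    have h8 : ‖(8 : ℤ_[5])‖ = 1 := by
      rw [show (8 : ℤ_[5]) = ((8 : ℕ) : ℤ_[5]) by norm_num, PadicInt.norm_natCast_eq_one_iff]; decide
    rw [h5, h8, mul_one]

/-- **`41` is a `5`-adic square**: `r ∈ ℤ₅`, `r² = 41`, `‖r - 1‖ < 1` (Hensel at `a = 1`:
`1 - 41 = -40`, `‖2‖ = 1`). [folklore] -/
theorem exists_sqrt41_five : ∃ r : ℤ_[5], r ^ 2 = 41 ∧ ‖r - 1‖ < 1 := by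
  have hder : ‖(Polynomial.derivative (Polynomial.X ^ 2 - 41 : Polynomial ℤ)).aeval (1 : ℤ_[5])‖ = 1 := by
    rw [aeval_derivative_sq_sub, mul_one, norm_two_five.1]
  have hF : ‖(Polynomial.X ^ 2 - 41 : Polynomial ℤ).aeval (1 : ℤ_[5])‖ <
      ‖(Polynomial.derivative (Polynomial.X ^ 2 - 41 : Polynomial ℤ)).aeval (1 : ℤ_[5])‖ ^ 2 := by
    rw [hder, aeval_sq_sub, show (1 : ℤ_[5]) ^ 2 - 41 = -40 by norm_num, _root_.norm_neg, norm_two_five.2]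
    norm_num
  obtain ⟨r, hr, hdist, -, -⟩ := hensels_lemma hF
  refine ⟨r, ?_, ?_⟩
  · rw [aeval_sq_sub] at hr
    linear_combination hr
  · rwa [hder] at hdist

/-- `√41 ∈ ℤ₅`, the root `≡ 1 (mod 5)` (in fact `≡ 21 (mod 25)`). [folklore] -/
def sqrt41Five : ℤ_[5] := Classical.choose exists_sqrt41_five

/-- `sqrt41Five² = 41`. [folklore] -/
theorem sqrt41Five_sq : sqrt41Five ^ 2 = 41 := (Classical.choose_spec exists_sqrt41_five).1

/-- `‖sqrt41Five - 1‖ < 1`. [folklore] -/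
theorem norm_sqrt41Five_sub : ‖sqrt41Five - 1‖ < 1 := (Classical.choose_spec exists_sqrt41_five).2

/-- `sqrt41Five ≡ 1 (mod 5)`. [folklore] -/
theorem toZModPow_one_sqrt41Five : PadicInt.toZModPow 1 sqrt41Five = 1 := by
  have h : sqrt41Five - 1 ∈ Ideal.span {((5 : ℕ) : ℤ_[5]) ^ 1} := by
    rw [← PadicInt.norm_le_pow_iff_mem_span_pow]
    have h' : ‖sqrt41Five - 1‖ < ((5 : ℕ) : ℝ) ^ (0 : ℤ) := by
      rw [zpow_zero]; exact norm_sqrt41Five_sub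
    have h'' := (PadicInt.norm_lt_pow_iff_norm_le_pow_sub_one _ _).mp h'
    have e : ((0 : ℤ) - 1) = -((1 : ℕ) : ℤ) := by norm_num
    rwa [e] at h''
  rw [← PadicInt.ker_toZModPow, RingHom.mem_ker, map_sub, map_one] at h
  exact sub_eq_zero.mp h

/-- In `ℤ/25`: a square root of `41` which is `1 mod 5` is `21`. [folklore] -/
theorem zmod25_sqrt41 : ∀ s : ZMod 25, s ^ 2 = 41 → s.val % 5 = 1 → s.val = 21 := by
  decide

/-- **`√41 ≡ 21 (mod 25)` in `ℤ₅`.** [folklore] -/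
theorem toZModPow_two_sqrt41Five : PadicInt.toZModPow 2 sqrt41Five = 21 := by
  have hsq : (PadicInt.toZModPow 2 sqrt41Five) ^ 2 = 41 := by
    rw [← map_pow, sqrt41Five_sq, show (41 : ℤ_[5]) = ((41 : ℕ) : ℤ_[5]) by norm_num, map_natCast]; rfl
  have h1 : (PadicInt.toZModPow 2 sqrt41Five).val % 5 = 1 := by
    have := val_toZModPow_mod 1 2 (by norm_num) sqrt41Five
    rw [toZModPow_one_sqrt41Five] at this
    exact this.trans (by decide)
  have h21 := zmod25_sqrt41 _ hsq h1
  apply ZMod.val_injective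
  rw [h21]
  decide

/-! ### Expansions of the roots -/

/-- `√41 = 13 + 64 t` in `ℤ₂`. [folklore] -/
theorem exists_sqrt41Two_eq : ∃ t : ℤ_[2], sqrt41Two = 13 + 2 ^ 6 * t := by
  have h : sqrt41Two - 13 ∈ RingHom.ker (PadicInt.toZModPow 6 : ℤ_[2] →+* ZMod (2 ^ 6)) := by
    rw [RingHom.mem_ker, map_sub, toZModPow_six_sqrt41Two,
      show (13 : ℤ_[2]) = ((13 : ℕ) : ℤ_[2]) by norm_num, map_natCast]
    decide
  rw [PadicInt.ker_toZModPow, Ideal.mem_span_singleton'] at h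
  obtain ⟨t, ht⟩ := h
  exact ⟨t, by rw [Nat.cast_ofNat] at ht; linear_combination -ht⟩

/-- `√41 = 21 + 25 t` in `ℤ₅`. [folklore] -/
theorem exists_sqrt41Five_eq : ∃ t : ℤ_[5], sqrt41Five = 21 + 5 ^ 2 * t := by
  have h : sqrt41Five - 21 ∈ RingHom.ker (PadicInt.toZModPow 2 : ℤ_[5] →+* ZMod (5 ^ 2)) := by
    rw [RingHom.mem_ker, map_sub, toZModPow_two_sqrt41Five,
      show (21 : ℤ_[5]) = ((21 : ℕ) : ℤ_[5]) by norm_num, map_natCast]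
    decide
  rw [PadicInt.ker_toZModPow, Ideal.mem_span_singleton'] at h
  obtain ⟨t, ht⟩ := h
  exact ⟨t, by rw [Nat.cast_ofNat] at ht; linear_combination -ht⟩

/-- A unit plus a multiple of `p` is a unit: `‖n + p t‖ = 1` for `‖n‖ = 1`, `t ∈ ℤ_p`.
[folklore] -/
theorem norm_add_mul_eq_one {p : ℕ} [Fact p.Prime] {n : ℚ_[p]} (hn : ‖n‖ = 1) (t : ℤ_[p]) {c : ℚ_[p]}
    (hc : ‖c‖ < 1) : ‖n + c * (t : ℚ_[p])‖ = 1 := by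
  have hct : ‖c * (t : ℚ_[p])‖ < 1 := by
    rw [norm_mul]
    calc ‖c‖ * ‖(t : ℚ_[p])‖ ≤ ‖c‖ * 1 := by
          gcongr; rw [PadicInt.padic_norm_e_of_padicInt]; exact t.2
      _ < 1 := by rw [mul_one]; exact hc
  have hne : ‖n‖ ≠ ‖c * (t : ℚ_[p])‖ := by rw [hn]; exact hct.ne'
  rw [Padic.add_eq_max_of_ne hne, hn, max_eq_left hct.le]

/-! ### The embeddings `K → ℚ₂`, `K → ℚ₅` -/

/-- A square root `u` of `41` in a `ℚ`-algebra, as a root datum for `QuadraticAlgebra.lift`.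
[folklore] -/
def rootDatum {A : Type*} [Ring A] [Algebra ℚ A] (u : A) (hu : u * u = 41) :
    {u : A // u * u = (41 : ℚ) • (1 : A) + (0 : ℚ) • u} :=
  ⟨u, by rw [zero_smul, add_zero, Algebra.smul_def, mul_one, map_ofNat]; exact hu⟩

/-- `sqrt41Two * sqrt41Two = 41` in `ℚ₂`. [folklore] -/
theorem sqrt41Two_mul_self : (sqrt41Two : ℚ_[2]) * sqrt41Two = 41 := by
  have := congrArg ((↑) : ℤ_[2] → ℚ_[2]) sqrt41Two_sq
  push_cast at this
  rw [← sq]; exact this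

/-- `sqrt41Five * sqrt41Five = 41` in `ℚ₅`. [folklore] -/
theorem sqrt41Five_mul_self : (sqrt41Five : ℚ_[5]) * sqrt41Five = 41 := by
  have := congrArg ((↑) : ℤ_[5] → ℚ_[5]) sqrt41Five_sq
  push_cast at this
  rw [← sq]; exact this

/-- The embedding `ι⁺ : K → ℚ₂`, `√41 ↦ sqrt41Two`. [folklore] -/
def ιpos : K →ₐ[ℚ] ℚ_[2] := QuadraticAlgebra.lift (rootDatum (sqrt41Two : ℚ_[2]) sqrt41Two_mul_self)

/-- The embedding `ι⁻ : K → ℚ₂`, `√41 ↦ -sqrt41Two`. [folklore] -/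
def ιneg : K →ₐ[ℚ] ℚ_[2] :=
  QuadraticAlgebra.lift (rootDatum (-(sqrt41Two : ℚ_[2])) (by rw [neg_mul_neg, sqrt41Two_mul_self]))

/-- The embedding `κ⁺ : K → ℚ₅`, `√41 ↦ sqrt41Five`. [folklore] -/
def κpos : K →ₐ[ℚ] ℚ_[5] := QuadraticAlgebra.lift (rootDatum (sqrt41Five : ℚ_[5]) sqrt41Five_mul_self)

/-- The embedding `κ⁻ : K → ℚ₅`, `√41 ↦ -sqrt41Five`. [folklore] -/
def κneg : K →ₐ[ℚ] ℚ_[5] :=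
  QuadraticAlgebra.lift (rootDatum (-(sqrt41Five : ℚ_[5])) (by rw [neg_mul_neg, sqrt41Five_mul_self]))

/-- `ι⁺ (x + y√41) = x + y · sqrt41Two`. [folklore] -/
theorem ιpos_apply (z : K) : ιpos z = (z.re : ℚ_[2]) + (z.im : ℚ_[2]) * sqrt41Two := by
  change z.re • (1 : ℚ_[2]) + z.im • (sqrt41Two : ℚ_[2]) = _
  rw [Rat.smul_one_eq_cast, Rat.smul_def]

/-- `ι⁻ (x + y√41) = x - y · sqrt41Two`. [folklore] -/
theorem ιneg_apply (z : K) : ιneg z = (z.re : ℚ_[2]) - (z.im : ℚ_[2]) * sqrt41Two := by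
  change z.re • (1 : ℚ_[2]) + z.im • (-(sqrt41Two : ℚ_[2])) = _
  rw [Rat.smul_one_eq_cast, Rat.smul_def]; ring

/-- `κ⁺ (x + y√41) = x + y · sqrt41Five`. [folklore] -/
theorem κpos_apply (z : K) : κpos z = (z.re : ℚ_[5]) + (z.im : ℚ_[5]) * sqrt41Five := by
  change z.re • (1 : ℚ_[5]) + z.im • (sqrt41Five : ℚ_[5]) = _
  rw [Rat.smul_one_eq_cast, Rat.smul_def]

/-- `κ⁻ (x + y√41) = x - y · sqrt41Five`. [folklore] -/
theorem κneg_apply (z : K) : κneg z = (z.re : ℚ_[5]) - (z.im : ℚ_[5]) * sqrt41Five := by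
  change z.re • (1 : ℚ_[5]) + z.im • (-(sqrt41Five : ℚ_[5])) = _
  rw [Rat.smul_one_eq_cast, Rat.smul_def]; ring

/-! ### The primes above `5` and the element `θ = √41` of `𝓞 K` -/

/-- `θ = √41 = 2φ - 1` as an algebraic integer. [folklore] -/
def θint : 𝓞 K := 2 * φint - 1

/-- `(θint : K) = θ`. [folklore] -/
@[simp] theorem coe_θint : ((θint : 𝓞 K) : K) = θ := by
  simp only [θint, map_sub, map_mul, map_ofNat, map_one, coe_φint]
  rw [two_mul_φ]; ring

/-- `θ² = 41` in `𝓞 K`. [folklore] -/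
theorem θint_sq : (θint : 𝓞 K) ^ 2 = 41 := by
  unfold θint
  linear_combination (4 : 𝓞 K) * φint_sq

/-- `π₅ = 6 + √41`, of norm `-5`. [folklore] -/
def π₅ : 𝓞 K := 6 + θint

/-- `π₅' = √41 - 6`, of norm `-5`. [folklore] -/
def π₅' : 𝓞 K := θint - 6

/-- `5 = π₅ π₅'` in `𝓞 K`. [folklore] -/
theorem π₅_mul_π₅' : π₅ * π₅' = 5 := by
  unfold π₅ π₅'
  linear_combination θint_sq

/-- `π₅` in `K`. [folklore] -/
theorem coe_π₅ : ((π₅ : 𝓞 K) : K) = 6 + θ := by simp [π₅, map_ofNat]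

/-- `π₅'` in `K`. [folklore] -/
theorem coe_π₅' : ((π₅' : 𝓞 K) : K) = θ - 6 := by simp [π₅', map_ofNat]

/-- `N((π₅)) = 5`. [folklore] -/
theorem absNorm_span_π₅ : Ideal.absNorm (Ideal.span {π₅}) = 5 :=
  absNorm_span_eq (by rw [coe_π₅]; simp [θ]; norm_num)

/-- `N((π₅')) = 5`. [folklore] -/
theorem absNorm_span_π₅' : Ideal.absNorm (Ideal.span {π₅'}) = 5 :=
  absNorm_span_eq (by rw [coe_π₅']; simp [θ]; norm_num)

/-- `(π₅)` is maximal. [folklore] -/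
theorem span_π₅_isMaximal : (Ideal.span {π₅}).IsMaximal :=
  span_isMaximal_of_absNorm (by norm_num) absNorm_span_π₅

/-- `(π₅')` is maximal. [folklore] -/
theorem span_π₅'_isMaximal : (Ideal.span {π₅'}).IsMaximal :=
  span_isMaximal_of_absNorm (by norm_num) absNorm_span_π₅'

/-- **The primes of `𝓞 K` containing `5` are `(π₅)` and `(π₅')`.** [folklore] -/
theorem eq_span_of_isPrime_of_five_mem {P : Ideal (𝓞 K)} (hP : P.IsPrime) (h5 : (5 : 𝓞 K) ∈ P) :
    P = Ideal.span {π₅} ∨ P = Ideal.span {π₅'} := by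
  rw [← π₅_mul_π₅'] at h5
  rcases hP.mem_or_mem h5 with h | h
  · left
    exact (span_π₅_isMaximal.eq_of_le hP.ne_top ((Ideal.span_singleton_le_iff_mem P).mpr h)).symm
  · right
    exact (span_π₅'_isMaximal.eq_of_le hP.ne_top ((Ideal.span_singleton_le_iff_mem P).mpr h)).symm

/-! ### The inert prime `3` -/

/-- **`3` is inert in `K`: every prime containing `3` is `(3)`** (`X² - X - 10` has no root mod
`3`; norms: `N(P) ∣ 9`, `N(P) = 3` would give a root in `𝓞 K/P ≅ 𝔽₃`). Adapted from the tree's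
`isPrincipal_of_mem_primesOver_of_no_root`. [folklore] -/
theorem eq_span_three {P : Ideal (𝓞 K)} (hP : P.IsPrime) (h3 : (3 : 𝓞 K) ∈ P) :
    P = Ideal.span {(3 : 𝓞 K)} := by
  have hle : Ideal.span {(3 : 𝓞 K)} ≤ P := (Ideal.span_singleton_le_iff_mem _).mpr h3
  have hNp : Ideal.absNorm (Ideal.span {(3 : 𝓞 K)}) = 3 ^ 2 := by
    rw [show (3 : 𝓞 K) = ((3 : ℕ) : 𝓞 K) by norm_num, Ideal.absNorm_span_natCast,
      NumberField.RingOfIntegers.rank, finrank_eq_two]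
  have hdvd : Ideal.absNorm P ∣ 3 ^ 2 := hNp ▸ Ideal.absNorm_dvd_absNorm_of_le hle
  obtain ⟨k, hk, hkeq⟩ := (Nat.dvd_prime_pow Nat.prime_three).mp hdvd
  interval_cases k
  · rw [pow_zero, Ideal.absNorm_eq_one_iff] at hkeq
    exact absurd hkeq hP.ne_top
  · exfalso
    rw [pow_one] at hkeq
    have hcard : Nat.card (𝓞 K ⧸ P) = 3 := by
      rw [← Submodule.cardQuot_apply, ← Ideal.absNorm_apply, hkeq]
    haveI : Finite (𝓞 K ⧸ P) := Nat.finite_of_card_ne_zero (by rw [hcard]; norm_num)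
    letI : Fintype (𝓞 K ⧸ P) := Fintype.ofFinite _
    have hcard' : Fintype.card (𝓞 K ⧸ P) = 3 := by rw [← Nat.card_eq_fintype_card, hcard]
    let e : ZMod 3 ≃+* 𝓞 K ⧸ P := ZMod.ringEquivOfPrime (𝓞 K ⧸ P) Nat.prime_three hcard'
    refine no_root_mod_three (e.symm (Ideal.Quotient.mk P φint)) ?_
    have h := congrArg (fun x : 𝓞 K => e.symm (Ideal.Quotient.mk P x)) φint_rel
    simpa [map_ofNat] using h
  · obtain ⟨J, hJ⟩ := Ideal.dvd_iff_le.mpr hle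
    have hJ1 : Ideal.absNorm J = 1 := by
      have h := congrArg Ideal.absNorm hJ
      rw [map_mul, hNp, hkeq] at h
      nlinarith [h]
    rw [Ideal.absNorm_eq_one_iff] at hJ1
    rw [hJ1, Ideal.mul_top] at hJ
    exact hJ.symm

/-- `(3)` is a maximal ideal of `𝓞 K`. [folklore] -/
theorem span_three_isMaximal : (Ideal.span {(3 : 𝓞 K)}).IsMaximal := by
  have hne : Ideal.span {(3 : 𝓞 K)} ≠ ⊤ := by
    intro h
    have := congrArg Ideal.absNorm h
    rw [show (3 : 𝓞 K) = ((3 : ℕ) : 𝓞 K) by norm_num, Ideal.absNorm_span_natCast,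
      NumberField.RingOfIntegers.rank, finrank_eq_two, Ideal.absNorm_top] at this
    norm_num at this
  obtain ⟨M, hM, hle⟩ := Ideal.exists_le_maximal _ hne
  have h3 : (3 : 𝓞 K) ∈ M := hle (Ideal.mem_span_singleton_self _)
  rw [← eq_span_three hM.isPrime h3]
  exact hM

/-- `3` is a prime element of `𝓞 K`. [folklore] -/
theorem prime_three : Prime (3 : 𝓞 K) :=
  (Ideal.span_singleton_prime (by norm_num)).mp span_three_isMaximal.isPrime

/-! ### Valuations of the prime elements under the embeddings -/

/-- `v₂(2) = 1` in `ℚ₂`. [folklore] -/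
theorem valuation_two' : (2 : ℚ_[2]).valuation = 1 := by
  have h := @Padic.valuation_p 2 _
  rwa [Nat.cast_ofNat] at h

/-- `v₅(5) = 1` in `ℚ₅`. [folklore] -/
theorem valuation_five' : (5 : ℚ_[5]).valuation = 1 := by
  have h := @Padic.valuation_p 5 _
  rwa [Nat.cast_ofNat] at h

/-- `v(-t) = v(t)` in `ℚ_p`. [folklore] -/
theorem valuation_neg'' {p : ℕ} [Fact p.Prime] (t : ℚ_[p]) : (-t).valuation = t.valuation := by
  by_cases ht : t = 0
  · rw [ht, neg_zero]
  · have h1 : (-1 : ℚ_[p]) ≠ 0 := neg_ne_zero.mpr one_ne_zero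
    have hv1 : (-1 : ℚ_[p]).valuation = 0 := by
      rw [show (-1 : ℚ_[p]) = ((-1 : ℚ) : ℚ_[p]) by push_cast; rfl, Padic.valuation_ratCast,
        padicValRat.neg, padicValRat.one]
    rw [← neg_one_mul, Padic.valuation_mul h1 ht, hv1, zero_add]

/-- A small odd number is a `2`-adic unit, a number prime to `5` a `5`-adic unit. [folklore] -/
theorem norm_natCast_units :
    ‖((5 : ℕ) : ℚ_[2])‖ = 1 ∧ ‖((16 : ℕ) : ℚ_[2])‖ < 1 ∧ ‖((3 : ℕ) : ℚ_[5])‖ = 1 ∧ ‖((5 : ℕ) : ℚ_[5])‖ < 1 := by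
  refine ⟨?_, ?_, ?_, ?_⟩
  · rw [Padic.norm_natCast_eq_one_iff]; decide
  · rw [Padic.norm_natCast_lt_one_iff]; decide
  · rw [Padic.norm_natCast_eq_one_iff]; decide
  · rw [Padic.norm_natCast_lt_one_iff]

/-- The coercion of `√41 = 13 + 64t` to `ℚ₂`. [folklore] -/
theorem coe_sqrt41Two_eq {t : ℤ_[2]} (ht : sqrt41Two = 13 + 2 ^ 6 * t) :
    ((sqrt41Two : ℤ_[2]) : ℚ_[2]) = 13 + 64 * (t : ℚ_[2]) := by
  rw [ht, PadicInt.coe_add, PadicInt.coe_mul, PadicInt.coe_pow,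
    show (13 : ℤ_[2]) = ((13 : ℕ) : ℤ_[2]) by norm_num, show (2 : ℤ_[2]) = ((2 : ℕ) : ℤ_[2]) by norm_num,
    PadicInt.coe_natCast, PadicInt.coe_natCast]
  norm_num

/-- The coercion of `√41 = 21 + 25t` to `ℚ₅`. [folklore] -/
theorem coe_sqrt41Five_eq {t : ℤ_[5]} (ht : sqrt41Five = 21 + 5 ^ 2 * t) :
    ((sqrt41Five : ℤ_[5]) : ℚ_[5]) = 21 + 25 * (t : ℚ_[5]) := by
  rw [ht, PadicInt.coe_add, PadicInt.coe_mul, PadicInt.coe_pow,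
    show (21 : ℤ_[5]) = ((21 : ℕ) : ℤ_[5]) by norm_num, show (5 : ℤ_[5]) = ((5 : ℕ) : ℤ_[5]) by norm_num,
    PadicInt.coe_natCast, PadicInt.coe_natCast]
  norm_num

/-- **`v₂(ι⁺ π₂) = 1`**: `ι⁺ π₂ = (7 + √41)/2 = 2(5 + 16t)`. [folklore] -/
theorem valuation_ιpos_π₂ : (ιpos ((π₂ : 𝓞 K) : K)).valuation = 1 := by
  obtain ⟨t, ht⟩ := exists_sqrt41Two_eq
  have e : ιpos ((π₂ : 𝓞 K) : K) = 2 * (((5 : ℕ) : ℚ_[2]) + ((16 : ℕ) : ℚ_[2]) * (t : ℚ_[2])) := by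
    rw [coe_π₂, map_add, map_ofNat, ιpos_apply, φ_re, φ_im, coe_sqrt41Two_eq ht]
    push_cast; ring
  have hn := norm_add_mul_eq_one norm_natCast_units.1 t norm_natCast_units.2.1
  have hne : ((5 : ℕ) : ℚ_[2]) + ((16 : ℕ) : ℚ_[2]) * (t : ℚ_[2]) ≠ 0 := by
    intro h0; rw [h0, _root_.norm_zero] at hn; exact zero_ne_one hn
  rw [e, Padic.valuation_mul two_ne_zero hne, valuation_two', valuation_eq_zero_of_norm_eq_one hn]
  rfl

/-- **`v₂(ι⁻ π₂') = 1`**: `ι⁻ π₂' = (7 + √41)/2` as well. [folklore] -/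
theorem valuation_ιneg_π₂' : (ιneg ((π₂' : 𝓞 K) : K)).valuation = 1 := by
  obtain ⟨t, ht⟩ := exists_sqrt41Two_eq
  have e : ιneg ((π₂' : 𝓞 K) : K) = 2 * (((5 : ℕ) : ℚ_[2]) + ((16 : ℕ) : ℚ_[2]) * (t : ℚ_[2])) := by
    rw [coe_π₂', map_sub, map_ofNat, ιneg_apply, φ_re, φ_im, coe_sqrt41Two_eq ht]
    push_cast; ring
  have hn := norm_add_mul_eq_one norm_natCast_units.1 t norm_natCast_units.2.1
  have hne : ((5 : ℕ) : ℚ_[2]) + ((16 : ℕ) : ℚ_[2]) * (t : ℚ_[2]) ≠ 0 := by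
    intro h0; rw [h0, _root_.norm_zero] at hn; exact zero_ne_one hn
  rw [e, Padic.valuation_mul two_ne_zero hne, valuation_two', valuation_eq_zero_of_norm_eq_one hn]
  rfl

/-- **`v₅(κ⁻ π₅) = 1`**: `κ⁻ π₅ = 6 - √41 = 5(-3 - 5t)`. [folklore] -/
theorem valuation_κneg_π₅ : (κneg ((π₅ : 𝓞 K) : K)).valuation = 1 := by
  obtain ⟨t, ht⟩ := exists_sqrt41Five_eq
  have e : κneg ((π₅ : 𝓞 K) : K) = 5 * -(((3 : ℕ) : ℚ_[5]) + ((5 : ℕ) : ℚ_[5]) * (t : ℚ_[5])) := by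
    rw [coe_π₅, map_add, map_ofNat, κneg_apply, θ_re, θ_im, coe_sqrt41Five_eq ht]
    push_cast; ring
  have hn := norm_add_mul_eq_one norm_natCast_units.2.2.1 t norm_natCast_units.2.2.2
  have hne : ((3 : ℕ) : ℚ_[5]) + ((5 : ℕ) : ℚ_[5]) * (t : ℚ_[5]) ≠ 0 := by
    intro h0; rw [h0, _root_.norm_zero] at hn; exact zero_ne_one hn
  have h5 : (5 : ℚ_[5]) ≠ 0 := by norm_num
  rw [e, Padic.valuation_mul h5 (neg_ne_zero.mpr hne), valuation_five', valuation_neg'',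
    valuation_eq_zero_of_norm_eq_one hn]
  rfl

/-- **`v₅(κ⁺ π₅') = 1`**: `κ⁺ π₅' = √41 - 6 = 5(3 + 5t)`. [folklore] -/
theorem valuation_κpos_π₅' : (κpos ((π₅' : 𝓞 K) : K)).valuation = 1 := by
  obtain ⟨t, ht⟩ := exists_sqrt41Five_eq
  have e : κpos ((π₅' : 𝓞 K) : K) = 5 * (((3 : ℕ) : ℚ_[5]) + ((5 : ℕ) : ℚ_[5]) * (t : ℚ_[5])) := by
    rw [coe_π₅', map_sub, map_ofNat, κpos_apply, θ_re, θ_im, coe_sqrt41Five_eq ht]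
    push_cast; ring
  have hn := norm_add_mul_eq_one norm_natCast_units.2.2.1 t norm_natCast_units.2.2.2
  have hne : ((3 : ℕ) : ℚ_[5]) + ((5 : ℕ) : ℚ_[5]) * (t : ℚ_[5]) ≠ 0 := by
    intro h0; rw [h0, _root_.norm_zero] at hn; exact zero_ne_one hn
  have h5 : (5 : ℚ_[5]) ≠ 0 := by norm_num
  rw [e, Padic.valuation_mul h5 hne, valuation_five', valuation_eq_zero_of_norm_eq_one hn]
  rfl

/-! ### The dictionary: `ord_𝔭 = v_p ∘ embedding` at the split primes -/

/-- `ord_(π₂) z = v₂(ι⁺ z)`. [folklore] -/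
theorem log_valuation_span_π₂ (v : HeightOneSpectrum (𝓞 K)) (hv : v.asIdeal = Ideal.span {π₂})
    {z : K} (hz : z ≠ 0) : log (v.valuation K z) = -(ιpos z).valuation :=
  log_valuation_eq_neg_valuation_embedding (ιpos : K →ₐ[ℚ] ℚ_[2]).toRingHom span_π₂_isMaximal
    valuation_ιpos_π₂ v hv hz

/-- `ord_(π₂') z = v₂(ι⁻ z)`. [folklore] -/
theorem log_valuation_span_π₂' (v : HeightOneSpectrum (𝓞 K)) (hv : v.asIdeal = Ideal.span {π₂'})
    {z : K} (hz : z ≠ 0) : log (v.valuation K z) = -(ιneg z).valuation :=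
  log_valuation_eq_neg_valuation_embedding (ιneg : K →ₐ[ℚ] ℚ_[2]).toRingHom span_π₂'_isMaximal
    valuation_ιneg_π₂' v hv hz

/-- `ord_(π₅) z = v₅(κ⁻ z)`. [folklore] -/
theorem log_valuation_span_π₅ (v : HeightOneSpectrum (𝓞 K)) (hv : v.asIdeal = Ideal.span {π₅})
    {z : K} (hz : z ≠ 0) : log (v.valuation K z) = -(κneg z).valuation :=
  log_valuation_eq_neg_valuation_embedding (κneg : K →ₐ[ℚ] ℚ_[5]).toRingHom span_π₅_isMaximal
    valuation_κneg_π₅ v hv hz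

/-- `ord_(π₅') z = v₅(κ⁺ z)`. [folklore] -/
theorem log_valuation_span_π₅' (v : HeightOneSpectrum (𝓞 K)) (hv : v.asIdeal = Ideal.span {π₅'})
    {z : K} (hz : z ≠ 0) : log (v.valuation K z) = -(κpos z).valuation :=
  log_valuation_eq_neg_valuation_embedding (κpos : K →ₐ[ℚ] ℚ_[5]).toRingHom span_π₅'_isMaximal
    valuation_κpos_π₅' v hv hz

/-! ### The dictionary at the inert prime: `2 ord_(3) = v₃ ∘ N` -/

/-- Galois conjugation on `𝓞 K` (`√41 ↦ -√41`). [folklore] -/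
def conjInt : 𝓞 K →+* 𝓞 K := NumberField.RingOfIntegers.mapRingHom (starRingEnd K)

/-- The conjugate in `K`. [folklore] -/
theorem coe_conjInt (w : 𝓞 K) : ((conjInt w : 𝓞 K) : K) = star (w : K) := rfl

/-- Conjugation is an involution. [folklore] -/
theorem conjInt_conjInt (w : 𝓞 K) : conjInt (conjInt w) = w := by
  apply RingOfIntegers.coe_injective
  show ((conjInt (conjInt w) : 𝓞 K) : K) = (w : K)
  rw [coe_conjInt, coe_conjInt, star_star]

/-- `N(w) = w · w̄` in `𝓞 K`. [folklore] -/
theorem intCast_norm_eq_mul_conj (w : 𝓞 K) : ((Algebra.norm ℤ w : ℤ) : 𝓞 K) = w * conjInt w := by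
  apply RingOfIntegers.coe_injective
  rw [map_mul, map_intCast]
  change ((Algebra.norm ℤ w : ℤ) : K) = (w : K) * star (w : K)
  rw [← algebraMap_norm_eq_mul_star, ← algNorm_eq_norm, ← Algebra.coe_norm_int, map_intCast]

/-- **`3 ∣ N(w) ⟹ 3 ∣ w`** (`3` is a prime element and `N(w) = w w̄`). [folklore] -/
theorem three_dvd_of_dvd_norm {w : 𝓞 K} (h : (3 : ℤ) ∣ Algebra.norm ℤ w) : (3 : 𝓞 K) ∣ w := by
  have h1 : (3 : 𝓞 K) ∣ w * conjInt w := by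
    rw [← intCast_norm_eq_mul_conj]
    obtain ⟨c, hc⟩ := h
    exact ⟨c, by rw [hc]; push_cast; ring⟩
  rcases prime_three.dvd_or_dvd h1 with h2 | h2
  · exact h2
  · obtain ⟨c, hc⟩ := h2
    refine ⟨conjInt c, ?_⟩
    rw [← conjInt_conjInt w, hc, map_mul, map_ofNat]

/-- `N(3) = 9`. [folklore] -/
theorem algNorm_three : Algebra.norm ℚ (3 : K) = 9 := by
  rw [show (3 : K) = algebraMap ℚ K 3 by simp [map_ofNat], Algebra.norm_algebraMap, finrank_eq_two]
  norm_num

/-- **`2 ord_(3) r = v₃(N r)`** for `r ∈ 𝓞 K`, `r ≠ 0`: write `r = 3ᵏ w` with `3 ∤ w`; then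
`ord_(3) r = k` and `N(r) = 9ᵏ N(w)` with `3 ∤ N(w)`. [folklore] -/
theorem two_mul_log_intValuation_three (v : HeightOneSpectrum (𝓞 K))
    (hv : v.asIdeal = Ideal.span {(3 : 𝓞 K)}) {r : 𝓞 K} (hr : r ≠ 0) :
    2 * log (v.intValuation r) = -padicValRat 3 (Algebra.norm ℚ (r : K)) := by
  haveI : Fact (Nat.Prime 3) := ⟨Nat.prime_three⟩
  obtain ⟨k, w, hw, rfl⟩ := WfDvdMonoid.max_power_factor' hr prime_three.not_unit
  have hw0 : w ≠ 0 := by rintro rfl; exact hr (mul_zero _)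
  -- ideal side
  have hv3 : v.intValuation (3 : 𝓞 K) = exp (-1 : ℤ) := intValuation_singleton _ (by norm_num) hv
  have hvw : v.intValuation w = 1 := by
    rw [intValuation_eq_one_iff, hv, Ideal.mem_span_singleton]; exact hw
  have h1 : log (v.intValuation (3 ^ k * w)) = -k := by
    rw [map_mul, map_pow, hv3, hvw, mul_one, ← exp_nsmul, log_exp]; simp
  -- norm side
  have hN : Algebra.norm ℚ (((3 ^ k * w : 𝓞 K)) : K) = 9 ^ k * (Algebra.norm ℤ w : ℚ) := by
    rw [show (((3 ^ k * w : 𝓞 K)) : K) = (3 : K) ^ k * (w : K) by push_cast; rfl, map_mul, map_pow,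
      algNorm_three, Algebra.coe_norm_int]
  have hndvd : ¬ (3 : ℤ) ∣ Algebra.norm ℤ w := fun h3 => hw (three_dvd_of_dvd_norm h3)
  have hvN : padicValRat 3 ((Algebra.norm ℤ w : ℤ) : ℚ) = 0 := by
    rw [padicValRat.of_int, padicValInt.eq_zero_of_not_dvd hndvd, Nat.cast_zero]
  have hN0 : ((Algebra.norm ℤ w : ℤ) : ℚ) ≠ 0 := by
    rw [Int.cast_ne_zero, Algebra.norm_ne_zero_iff]; exact hw0
  have h9 : padicValRat 3 ((9 : ℚ) ^ k) = 2 * k := by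
    rw [padicValRat.pow, show (9 : ℚ) = ((3 : ℕ) : ℚ) ^ 2 by norm_num, padicValRat.pow,
      padicValRat.self (by norm_num)]
    ring
  rw [h1, hN, padicValRat.mul (pow_ne_zero _ (by norm_num)) hN0, h9, hvN]
  ring

/-- **`2 ord_(3) z = v₃(N z)`** for `z ∈ Kˣ`. [folklore] -/
theorem two_mul_log_valuation_three (v : HeightOneSpectrum (𝓞 K))
    (hv : v.asIdeal = Ideal.span {(3 : 𝓞 K)}) {z : K} (hz : z ≠ 0) :
    2 * log (v.valuation K z) = -padicValRat 3 (Algebra.norm ℚ z) := by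
  haveI : Fact (Nat.Prime 3) := ⟨Nat.prime_three⟩
  obtain ⟨a, b, hb, rfl⟩ := IsFractionRing.div_surjective (A := 𝓞 K) z
  have hb0 : b ≠ 0 := nonZeroDivisors.ne_zero hb
  have ha0 : a ≠ 0 := by
    rintro rfl; rw [map_zero, zero_div] at hz; exact hz rfl
  have hva : v.intValuation a ≠ 0 := v.intValuation_ne_zero a ha0
  have hvb : v.intValuation b ≠ 0 := v.intValuation_ne_zero b hb0
  have hbK : algebraMap (𝓞 K) K b ≠ 0 := RingOfIntegers.coe_ne_zero_iff.mpr hb0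
  have hNb : Algebra.norm ℚ (algebraMap (𝓞 K) K b) ≠ 0 := Algebra.norm_ne_zero_iff.mpr hbK
  have hNz : Algebra.norm ℚ (algebraMap (𝓞 K) K a / algebraMap (𝓞 K) K b) ≠ 0 :=
    Algebra.norm_ne_zero_iff.mpr hz
  have hmul : Algebra.norm ℚ (algebraMap (𝓞 K) K a / algebraMap (𝓞 K) K b) *
      Algebra.norm ℚ (algebraMap (𝓞 K) K b) = Algebra.norm ℚ (algebraMap (𝓞 K) K a) := by
    rw [← map_mul, div_mul_cancel₀ _ hbK]
  have hvp := congrArg (padicValRat 3) hmul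
  rw [padicValRat.mul hNz hNb] at hvp
  rw [Valuation.map_div, valuation_of_algebraMap, valuation_of_algebraMap, log_div hva hvb, mul_sub,
    two_mul_log_intValuation_three v hv ha0, two_mul_log_intValuation_three v hv hb0]
  rw [← RingOfIntegers.coe_eq_algebraMap, ← RingOfIntegers.coe_eq_algebraMap] at hvp
  rw [← RingOfIntegers.coe_eq_algebraMap, ← RingOfIntegers.coe_eq_algebraMap]
  linarith

/-! ### The square theorem in local terms -/

/-- **The square theorem for `K = ℚ(√41)` in local terms.** Let `z ∈ Kˣ` have even valuation at
every prime not dividing `30`; suppose `v₂(ι⁺ z)`, `v₂(ι⁻ z)` are even, `4 ∣ v₃(N z)`,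
`v₅(κ⁺ z)`, `v₅(κ⁻ z)` are even, and `σ⁺ z, σ⁻ z > 0`. Then `z` is a square in `K`.
(Class number one, totally positive units are squares, and the dictionary between the primes
above `2, 3, 5` and the embeddings / the norm.) [folklore] -/
theorem exists_sq_eq_of_local_data {z : K} (hz : z ≠ 0)
    (hS : ∀ v : HeightOneSpectrum (𝓞 K), (30 : 𝓞 K) ∉ v.asIdeal → (2 : ℤ) ∣ log (v.valuation K z))
    (h2p : Even (ιpos z).valuation) (h2n : Even (ιneg z).valuation)
    (h3 : (4 : ℤ) ∣ padicValRat 3 (Algebra.norm ℚ z))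
    (h5p : Even (κpos z).valuation) (h5n : Even (κneg z).valuation)
    (hpos : 0 < σpos z) (hpos' : 0 < σneg z) : ∃ w : K, z = w ^ 2 := by
  refine isSquare_of_forall_two_dvd_of_pos hz (fun v => ?_) hpos hpos'
  by_cases h30 : (30 : 𝓞 K) ∈ v.asIdeal
  swap
  · exact hS v h30
  have hP := v.isPrime
  rw [show (30 : 𝓞 K) = 2 * 3 * 5 by norm_num] at h30
  rcases hP.mem_or_mem h30 with h23 | h5
  · rcases hP.mem_or_mem h23 with h2 | h3'
    · rcases eq_span_of_isPrime_of_two_mem hP h2 with hv | hv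
      · rw [log_valuation_span_π₂ v hv hz]
        exact (even_neg.mpr h2p).two_dvd
      · rw [log_valuation_span_π₂' v hv hz]
        exact (even_neg.mpr h2n).two_dvd
    · have hv := eq_span_three hP h3'
      have h := two_mul_log_valuation_three v hv hz
      obtain ⟨m, hm⟩ := h3
      exact ⟨-m, by omega⟩
  · rcases eq_span_of_isPrime_of_five_mem hP h5 with hv | hv
    · rw [log_valuation_span_π₅ v hv hz]
      exact (even_neg.mpr h5n).two_dvd
    · rw [log_valuation_span_π₅' v hv hz]
      exact (even_neg.mpr h5p).two_dvd

end Literature.NumberTheory.QuadraticFields.Sqrt41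

end
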